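import Summits.BirchSwinnertonDyer.BirchSwinnertonDyer.Theorems.EisensteinPrimesCrystalKernel
import Summits.BirchSwinnertonDyer.BirchSwinnertonDyer.Theorems.EisensteinPrimesBSDpOnCellCResidualV11
import Summits.BirchSwinnertonDyer.BirchSwinnertonDyer.Theorems.EisensteinPrimesKellerYinLemma511OfBr
import Summits.BirchSwinnertonDyer.BirchSwinnertonDyer.Theorems.EisensteinPrimesKellerYinBROmegaLightBridges
import Summits.BirchSwinnertonDyer.BirchSwinnertonDyer.Theorems.EisensteinPrimesBSDpOnCellCImprimitiveCountSplitTransport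
import Summits.BirchSwinnertonDyer.BirchSwinnertonDyer.Theorems.EisensteinPrimesBSDpOnCellCImprimitiveCountSplitOfBrHlatLightTC
import Summits.BirchSwinnertonDyer.BirchSwinnertonDyer.Theorems.EisensteinPrimesResidualCharacterSelmerFiniteOfFact
import Summits.BirchSwinnertonDyer.Rank1Residual.X2.CpIntSeriesCongruenceLimit
import Literature.NumberTheory.EllipticCurves.Skinner2016.HidaCongruentMembers
import Literature.NumberTheory.EllipticCurves.BDPAnticyclotomicPAdicLFunctionSigmaInt
import Literature.NumberTheory.EllipticCurves.SigmaEulerData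
import Summits.BirchSwinnertonDyer.BirchSwinnertonDyer.Theorems.ErratumRoadFiveSigmaEulerFactorFirstUnitCoeff
import Summits.BirchSwinnertonDyer.BirchSwinnertonDyer.Theorems.EisensteinPrimesNumPlacesAboveRepresentatives
import Summits.BirchSwinnertonDyer.BirchSwinnertonDyer.Theorems.UniversalToricDescentSigmaEulerMuZero
import Summits.BirchSwinnertonDyer.BirchSwinnertonDyer.Theorems.ErratumRoadFiveIMCDivRoadFFSigmaDataBNoDefect
import Summits.BirchSwinnertonDyer.Rank1Residual.X11b.RouteR1IntReceptacle
import Literature.NumberTheory.EllipticCurves.KellerYin2024.AnticyclotomicLocalEulerFactors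
import Literature.NumberTheory.EllipticCurves.HasseWeilAbelianBadReduction
import Literature.NumberTheory.EllipticCurves.HasseWeilGoodReductionFrobenius
import Literature.NumberTheory.GaloisCohomology.CyclotomicCharacterPPrimary
import Literature.NumberTheory.GaloisRepresentations.LocalFrobeniusDensity
import HarnessLib

/-!
# Line «crystal» of crux 4 `BSDpOnCellC` (stmt-BirchSwinnertonDyer-19034) — the μ-TRANSPORT and the [BRω-split] bridge as TREE THEOREMS:
# b1 v12's `stub_muFrame` (μ(𝓛^BDP_𝔭(f_E)) = 0, both signs) DERIVED from (I) the crystalline fibre + (i) μ = 0 at the member; the non-split member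
# λ-count from the sign-free one
# (cell `bsd-eis`; mathematics and Lean text by ideator bsd-idea-12 g12–g14 (`Lines/crystal.lean` v1–v4.1) and the LEAD cruxlead-19034 g0 (v6–v7),
# sorry-free in the registered skeleton; landed under `Theorems/` by the LEAD so that the composition of record can be a tree theorem;
# `--supports stmt-BirchSwinnertonDyer-19034`; namespace `…Theorems.CrystalTransports`, texts otherwise VERBATIM from `Lines/crystal.lean` v7)

HONEST FRAMING (run/shared/lean/pub/bsd-eis/): IMPLICATIONS between hypothesis-shaped statements (the registered stub texts appear only as
HYPOTHESES); 0 defs, 0 named facts, 0 sorry; nothing about any curve is asserted; no summit statement / BSD / MC / IMC is proved; 0 cells / labels /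
tiers move. `muFrame_of_crystallineFibre_of_memberMuZero : (I) → (i) → <b1 v12 stub_muFrame VERBATIM>` (kernel `CrystalfirstUnitCoeffAt_of_span_sup_eq`
∘ `exists_firstUnitCoeffAt_of_mul`); `memberLambdaCount_of_free : (ii′) → (ii)`; (the bridge [BRω-split]-LIGHT → x2-p2's medium text is x2-p2 g12's tree theorem
`ImprimitiveCountWallOfInputs.brOmegaSplit_medium_of_light`, not restated here).

References: [Washington1997] §7.1; [EmertonPollackWeston2006] Thm. 1; [CastellaGrossiLeeSkinner2022] Thm. 1.2.2, Thm. 2.2.2 with (2.16);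
[Kriz2016] Thm. 3, Thm. 34, Prop. 37; [KellerYin2024] §5.1 (b) (arXiv:2402.12781v2); cell `Lines/crystal.md` r7.
-/

set_option autoImplicit false
set_option linter.dupNamespace false

noncomputable section

open scoped Classical MatrixGroups ModularForm

open CongruenceSubgroup WeierstrassCurve NumberField IsDedekindDomain Field PowerSeries
  Literature.NumberTheory.EllipticCurves Literature.NumberTheory.EllipticCurves.GreenbergSelmer
  Literature.NumberTheory.EllipticCurves.ModularForms Literature.NumberTheory.QuadraticFields
  Literature.NumberTheory.EllipticCurves.Rank1Residual
  Literature.NumberTheory.EllipticCurves.Rank1Residual.Typed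
  Literature.NumberTheory.EllipticCurves.KrizLi2019
  Literature.NumberTheory.EllipticCurves.GreenbergVatsal2000
  Literature.NumberTheory.EllipticCurves.Wuthrich2014
  Literature.NumberTheory.EllipticCurves.SteinWuthrich2013
  Literature.NumberTheory.EllipticCurves.Castella2018Exceptional
  Literature.NumberTheory.GaloisRepresentations Literature.NumberTheory.GaloisCohomology
  Literature.NumberTheory.Automorphic
  Summit.BirchSwinnertonDyer.Rank1Residual.X11b.AcSelmer
  Summit.BirchSwinnertonDyer.Rank1Residual.X11b.Halves
  Summit.BirchSwinnertonDyer.Rank1Residual.X11b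
  Summit.BirchSwinnertonDyer.Rank1Residual Summit.BirchSwinnertonDyer.Rank1Residual.X1
  Summit.BirchSwinnertonDyer.Rank1Residual.X2
open Literature.NumberTheory.EllipticCurves.KellerYin2024 (curveLocalLambda)

namespace Summit.BirchSwinnertonDyer.BirchSwinnertonDyer.Theorems.CrystalTransports

open Literature.NumberTheory.EllipticCurves.CastellaGrossiLeeSkinner2022 Literature.NumberTheory.EllipticCurves.Castella2018
  Literature.NumberTheory.IwasawaTheory Literature.NumberTheory.IwasawaTheory.Greenberg2016
  Literature.NumberTheory.IwasawaTheory.Greenberg2006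
  Summit.BirchSwinnertonDyer.Rank1Residual.X1.KellerYinMuLambdaSplit
open Literature.NumberTheory.EllipticCurves.KellerYin2024
open Summit.BirchSwinnertonDyer.BirchSwinnertonDyer.Theorems.CrystalKernel (firstUnitCoeffAt_of_span_sup_eq exists_firstUnitCoeffAt_of_mul)

/-- **b1 v12's `stub_muFrame`, DERIVED** from `stub_crystallineFibre` (I) and `stub_memberInvariants.1` (i) by the kernel
transport §K (v1's theorem; the parity clause of (I) is simply discarded): `(Q_{g₁}) + (p) = (Q·P_Σ) + (p)` and `μ(Q_{g₁}) = 0`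
give a first unit coefficient of `Q·P_Σ` (`firstUnitCoeffAt_of_span_sup_eq`), hence one of `Q`
(`exists_firstUnitCoeffAt_of_mul`). Statement = b1 v12 `stub_muFrame` character for character. [cite: Washington1997, §7.1]
[cite: EmertonPollackWeston2006, Thm. 1 (the move)] -/
theorem muFrame_of_crystallineFibre_of_memberMuZero
    (hF :
      ∀ (W : WeierstrassCurve ℚ) [W.IsElliptic] [W.IsGloballyMinimal] (p : ℕ) [Fact p.Prime],
        ∀ (N : ℕ) [NeZero N] (K : Type) [Field K] [NumberField K],
          CellC W p → W.conductorNorm ℤ = N →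
          IsImaginaryQuadratic K → NumberField.discr K < -4 → SatisfiesHeegnerHypothesis N K →
          Odd (NumberField.discr K) →
          ∀ (κ : ZpExtension K p), κ.IsAnticyclotomic →
            ∀ (γ : Field.absoluteGaloisGroup K) [Fact (κ.IsTopGenerator γ)]
              (𝔭 : HeightOneSpectrum (𝓞 K)), ((p : ℕ) : 𝓞 K) ∈ 𝔭.asIdeal →
              𝔭.asIdeal.ramificationIdx (𝓞 ℚ) = 1 → 𝔭.asIdeal.inertiaDeg (𝓞 ℚ) = 1 →
              ∀ (𝔭bar : HeightOneSpectrum (𝓞 K)), ((p : ℕ) : 𝓞 K) ∈ 𝔭bar.asIdeal → 𝔭bar ≠ 𝔭 →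
                ((Ideal.span {(p : ℤ)}).primesOver (𝓞 K)).ncard = 2 →
              ∀ (f : CuspForm (CongruenceSubgroup.Gamma0 N) 2), IsNewformOf W f →
                ∀ (ι' : PadicAlgCl p ≃+* ℂ),
                  (∀ (w : InfinitePlace K) (k : 𝓞 K),
                    k ∈ 𝔭.asIdeal ↔ ‖ι'.symm (w.embedding (k : K))‖ < 1) →
                  ∀ (ΩK : ℂ) (Ωp : ℂ_[p]) (Q : PowerSeries 𝓞_ℂ_[p]), ΩK ≠ 0 → ‖Ωp‖ = 1 →
                    R1.IsBDPLFunctionInt p ι' 𝔭 κ γ f ΩK Ωp Q →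
                    ∃ (D : Skinner2016.HidaCongruentForm W p 1) (ΩK' : ℂ) (Ωp' : ℂ_[p])
                      (Qg : PowerSeries 𝓞_ℂ_[p]),
                      (∀ x : coeffField D.g, ι' (D.ι x) = (x : ℂ)) ∧ 2 * ((p : ℤ) - 1) ∣ D.k - 2 ∧
                      ΩK' ≠ 0 ∧ ‖Ωp'‖ = 1 ∧
                      IsBDPLFunctionWtSigmaInt ι' 𝔭 κ γ D.g (W.sigmaPlacesFinset p K) ΩK' Ωp' Qg ∧
                      Ideal.span {Qg} ⊔ Ideal.span {(C ((p : ℕ) : 𝓞_ℂ_[p]) : PowerSeries 𝓞_ℂ_[p])} =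
                        Ideal.span {Q * PowerSeries.map (R1.toCpInt p) (W.sigmaEulerElement p K κ)} ⊔
                          Ideal.span {(C ((p : ℕ) : 𝓞_ℂ_[p]) : PowerSeries 𝓞_ℂ_[p])})
    (hM :
      ∀ (W : WeierstrassCurve ℚ) [W.IsElliptic] [W.IsGloballyMinimal] (p : ℕ) [Fact p.Prime],
        ∀ (N : ℕ) [NeZero N] (K : Type) [Field K] [NumberField K],
          CellC W p → W.conductorNorm ℤ = N →
          IsImaginaryQuadratic K → NumberField.discr K < -4 → SatisfiesHeegnerHypothesis N K →
          Odd (NumberField.discr K) →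
          ∀ (κ : ZpExtension K p), κ.IsAnticyclotomic →
            ∀ (γ : Field.absoluteGaloisGroup K) [Fact (κ.IsTopGenerator γ)]
              (𝔭 : HeightOneSpectrum (𝓞 K)), ((p : ℕ) : 𝓞 K) ∈ 𝔭.asIdeal →
                ((Ideal.span {(p : ℤ)}).primesOver (𝓞 K)).ncard = 2 →
              ∀ (ι' : PadicAlgCl p ≃+* ℂ),
                (∀ (w : InfinitePlace K) (k : 𝓞 K),
                  k ∈ 𝔭.asIdeal ↔ ‖ι'.symm (w.embedding (k : K))‖ < 1) →
                ∀ (D : Skinner2016.HidaCongruentForm W p 1), (∀ x : coeffField D.g, ι' (D.ι x) = (x : ℂ)) →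
                  ∀ (ΩK' : ℂ) (Ωp' : ℂ_[p]) (Qg : PowerSeries 𝓞_ℂ_[p]), ΩK' ≠ 0 → ‖Ωp'‖ = 1 →
                    IsBDPLFunctionWtSigmaInt ι' 𝔭 κ γ D.g (W.sigmaPlacesFinset p K) ΩK' Ωp' Qg →
                      ∃ n : ℕ, ‖((PowerSeries.coeff n Qg : 𝓞_ℂ_[p]) : ℂ_[p])‖ = 1 ∧
                        ∀ i < n, ‖((PowerSeries.coeff i Qg : 𝓞_ℂ_[p]) : ℂ_[p])‖ < 1) :
    (∀ (W : WeierstrassCurve ℚ) [W.IsElliptic] [W.IsGloballyMinimal] (p : ℕ) [Fact p.Prime],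
      ∀ (N : ℕ) [NeZero N] (K : Type) [Field K] [NumberField K] (Dt : ModularParametrizationData W N)
        (H : HeegnerDatum N (NumberField.discr K)) (ιK : K →+* ℂ) (P : (W.baseChange K).toAffine.Point),
        CellC W p → ¬ W.HasSplitMultiplicativeReductionAtPrime p → W.conductorNorm ℤ = N →
        IsImaginaryQuadratic K → NumberField.discr K < -4 → SatisfiesHeegnerHypothesis N K →
        (W.quadraticTwist (NumberField.discr K : ℚ)).entireLFunction 1 ≠ 0 →
        WeierstrassCurve.Affine.Point.map ιK.toRatAlgHom P = heegnerPointComplex Dt H →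
        ¬ (p : ℤ) ∣ Dt.c → ¬ IsOfFinAddOrder P →
        Odd (NumberField.discr K) →
        ∀ (κ : ZpExtension K p), κ.IsAnticyclotomic →
          ∀ (γ : Field.absoluteGaloisGroup K) [Fact (κ.IsTopGenerator γ)]
            (𝔭 : HeightOneSpectrum (𝓞 K)), ((p : ℕ) : 𝓞 K) ∈ 𝔭.asIdeal →
            𝔭.asIdeal.ramificationIdx (𝓞 ℚ) = 1 → 𝔭.asIdeal.inertiaDeg (𝓞 ℚ) = 1 →
            ∀ (𝔭bar : HeightOneSpectrum (𝓞 K)), ((p : ℕ) : 𝓞 K) ∈ 𝔭bar.asIdeal → 𝔭bar ≠ 𝔭 →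
              ((Ideal.span {(p : ℤ)}).primesOver (𝓞 K)).ncard = 2 →
            ∀ (f : CuspForm (CongruenceSubgroup.Gamma0 N) 2), IsNewformOf W f →
              ∀ (ι' : PadicAlgCl p ≃+* ℂ),
                (∀ (w : InfinitePlace K) (k : 𝓞 K),
                  k ∈ 𝔭.asIdeal ↔ ‖ι'.symm (w.embedding (k : K))‖ < 1) →
                ∀ (ΩK : ℂ) (Ωp : ℂ_[p]) (Q : PowerSeries 𝓞_ℂ_[p]), ΩK ≠ 0 → ‖Ωp‖ = 1 →
                  R1.IsBDPLFunctionInt p ι' 𝔭 κ γ f ΩK Ωp Q →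
                    ∃ m : ℕ, ‖((PowerSeries.coeff m Q : 𝓞_ℂ_[p]) : ℂ_[p])‖ = 1 ∧
                  ∀ i < m, ‖((PowerSeries.coeff i Q : 𝓞_ℂ_[p]) : ℂ_[p])‖ < 1) ∧
    (∀ (W : WeierstrassCurve ℚ) [W.IsElliptic] [W.IsGloballyMinimal] (p : ℕ) [Fact p.Prime],
      ∀ (N : ℕ) [NeZero N] (K : Type) [Field K] [NumberField K] (Dt : ModularParametrizationData W N)
        (H : HeegnerDatum N (NumberField.discr K)) (ιK : K →+* ℂ) (P : (W.baseChange K).toAffine.Point),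
        CellC W p → W.HasSplitMultiplicativeReductionAtPrime p → W.conductorNorm ℤ = N →
        IsImaginaryQuadratic K → NumberField.discr K < -4 → SatisfiesHeegnerHypothesis N K →
        (W.quadraticTwist (NumberField.discr K : ℚ)).entireLFunction 1 ≠ 0 →
        WeierstrassCurve.Affine.Point.map ιK.toRatAlgHom P = heegnerPointComplex Dt H →
        ¬ (p : ℤ) ∣ Dt.c → ¬ IsOfFinAddOrder P →
        Odd (NumberField.discr K) →
        ∀ (κ : ZpExtension K p), κ.IsAnticyclotomic →
          ∀ (γ : Field.absoluteGaloisGroup K) [Fact (κ.IsTopGenerator γ)]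
            (𝔭 : HeightOneSpectrum (𝓞 K)), ((p : ℕ) : 𝓞 K) ∈ 𝔭.asIdeal →
            𝔭.asIdeal.ramificationIdx (𝓞 ℚ) = 1 → 𝔭.asIdeal.inertiaDeg (𝓞 ℚ) = 1 →
            ∀ (𝔭bar : HeightOneSpectrum (𝓞 K)), ((p : ℕ) : 𝓞 K) ∈ 𝔭bar.asIdeal → 𝔭bar ≠ 𝔭 →
              ((Ideal.span {(p : ℤ)}).primesOver (𝓞 K)).ncard = 2 →
            ∀ (f : CuspForm (CongruenceSubgroup.Gamma0 N) 2), IsNewformOf W f →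
              ∀ (ι' : PadicAlgCl p ≃+* ℂ),
                (∀ (w : InfinitePlace K) (k : 𝓞 K),
                  k ∈ 𝔭.asIdeal ↔ ‖ι'.symm (w.embedding (k : K))‖ < 1) →
                ∀ (ΩK : ℂ) (Ωp : ℂ_[p]) (Q : PowerSeries 𝓞_ℂ_[p]), ΩK ≠ 0 → ‖Ωp‖ = 1 →
                  R1.IsBDPLFunctionInt p ι' 𝔭 κ γ f ΩK Ωp Q →
                    ∃ m : ℕ, ‖((PowerSeries.coeff m Q : 𝓞_ℂ_[p]) : ℂ_[p])‖ = 1 ∧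
                  ∀ i < m, ‖((PowerSeries.coeff i Q : 𝓞_ℂ_[p]) : ℂ_[p])‖ < 1) := by
  constructor
  all_goals
    intro W _ _ p _ N _ K _ _ Dt H ιK P hC _hsgn hN hK hD4 hHg hL1 hPt hc hP hodd κ hκ γ _ 𝔭 h𝔭 he hdeg
      𝔭bar h𝔭bar hne hsp f hf ι' hι' ΩK Ωp Q hΩK hΩp hQ
    obtain ⟨D, ΩK', Ωp', Qg, hDι, -, hΩK', hΩp', hQg, hcong⟩ :=
      hF W p N K hC hN hK hD4 hHg hodd κ hκ γ 𝔭 h𝔭 he hdeg 𝔭bar h𝔭bar hne hsp f hf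
        ι' hι' ΩK Ωp Q hΩK hΩp hQ
    obtain ⟨n, hn⟩ := hM W p N K hC hN hK hD4 hHg hodd κ hκ γ 𝔭 h𝔭 hsp ι' hι' D hDι ΩK' Ωp' Qg hΩK' hΩp' hQg
    obtain ⟨m, -, hm⟩ := exists_firstUnitCoeffAt_of_mul (firstUnitCoeffAt_of_span_sup_eq hcong hn)
    exact ⟨m, hm⟩

/-- **The SIGN-FREE member λ-count implies (ii)** (v4.1). The hypothesis `hL` below — written out, deliberately NOT a
`def … : Prop` under `Summit.*` (tree.vendored-fact lint) and NOT a stub — is conjunct (ii) of `stub_memberInvariants` with the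
binder `¬ W.HasSplitMultiplicativeReductionAtPrime p` deleted: the λ-count at the crystalline member `g₁` for Eisenstein data of
EITHER reduction sign at `p` (the member is GOOD at `p`; Kriz's congruence Thm. 3 / Λ-adic Thm. 34, Prop. 37 has no sign
hypothesis). It is the third input of the split plug `hanSplit_of_…` and trivially implies (ii) (this theorem); it is kept OUT of
the load-bearing stub so that `BSDpOnCellC_of` is exposed only to the non-split case it needs (the split case meets the anomalous
branch `φ|_{G_v̄} = 𝟙`, rider (f) of the card). BC7 probe of this hypothesis as a Prop: CLEAN (HOME bc/probe7-crystal-v4.out).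
[cite: Kriz2016, Thm. 3, Thm. 34, Prop. 37 (arXiv:1512.05032)] [cite: CastellaGrossiLeeSkinner2022, §2.2.1–2.2.2, (2.16)] -/
theorem memberLambdaCount_of_free
    (hL :
      ∀ (W : WeierstrassCurve ℚ) [W.IsElliptic] [W.IsGloballyMinimal] (p : ℕ) [Fact p.Prime],
        ∀ (N : ℕ) [NeZero N] (K : Type) [Field K] [NumberField K],
          CellC W p → W.conductorNorm ℤ = N →
          IsImaginaryQuadratic K → NumberField.discr K < -4 → SatisfiesHeegnerHypothesis N K →
          Odd (NumberField.discr K) →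
          ∀ (κ : ZpExtension K p), κ.IsAnticyclotomic →
            ∀ (γ : Field.absoluteGaloisGroup K) [Fact (κ.IsTopGenerator γ)]
              (𝔭 : HeightOneSpectrum (𝓞 K)), ((p : ℕ) : 𝓞 K) ∈ 𝔭.asIdeal →
              𝔭.asIdeal.ramificationIdx (𝓞 ℚ) = 1 → 𝔭.asIdeal.inertiaDeg (𝓞 ℚ) = 1 →
              ∀ (𝔭bar : HeightOneSpectrum (𝓞 K)), ((p : ℕ) : 𝓞 K) ∈ 𝔭bar.asIdeal → 𝔭bar ≠ 𝔭 →
                ((Ideal.span {(p : ℤ)}).primesOver (𝓞 K)).ncard = 2 →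
              ∀ (ι' : PadicAlgCl p ≃+* ℂ),
                (∀ (w : InfinitePlace K) (k : 𝓞 K),
                  k ∈ 𝔭.asIdeal ↔ ‖ι'.symm (w.embedding (k : K))‖ < 1) →
                ∀ (D : Skinner2016.HidaCongruentForm W p 1), (∀ x : coeffField D.g, ι' (D.ι x) = (x : ℂ)) →
                  2 * ((p : ℤ) - 1) ∣ D.k - 2 →
                  ∀ (ΩKg : ℂ) (Ωpg : ℂ_[p]) (Qg : PowerSeries 𝓞_ℂ_[p]), ΩKg ≠ 0 → ‖Ωpg‖ = 1 →
                    IsBDPLFunctionWtSigmaInt ι' 𝔭 κ γ D.g (W.sigmaPlacesFinset p K) ΩKg Ωpg Qg →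
                    ∀ (Φ : AddSubgroup (geomTorsion W (p : ℤ))), IsRationalLine W p Φ →
                    ∀ (θsub θquot : FramedGaloisRep ℚ (padicCoeffIntegers (∅ : Set (PadicAlgCl p))) 1),
                      IsTeichmullerLiftOn (∅ : Set (PadicAlgCl p)) (Φ.map (geomTorsion W (p : ℤ)).subtype) θsub →
                      IsTeichmullerLiftOnQuot (∅ : Set (PadicAlgCl p)) (Φ.map (geomTorsion W (p : ℤ)).subtype)
                        (geomTorsion W (p : ℤ)) θquot →
                    ∀ (φ ψ : FramedGaloisRep ℚ (padicCoeffIntegers (∅ : Set (PadicAlgCl p))) 1),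
                      (φ = θsub ∧ ψ = θquot ∨ φ = θquot ∧ ψ = θsub) →
                      (∀ u : HeightOneSpectrum (𝓞 ℚ), ((p : ℕ) : 𝓞 ℚ) ∈ u.asIdeal → φ.IsUnramifiedAt u) →
                    ∀ (θK : HeckeCharacter K), IsHeckeCharOf ι' (φ.restrictField K) θK →
                    ∀ (Cbar : Finset (HeightOneSpectrum (𝓞 K))), (∀ u ∈ Cbar, ¬ θK.IsUnramifiedAt u) →
                    ∀ (ΩK' : ℂ) (Ωp' : (unrIntegers p)ˣ) (Lφ : UnrSeries p), ΩK' ≠ 0 →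
                      IsKatzLFunction ι' 𝔭 𝔭bar Cbar κ γ θK ΩK' ((Ωp' : unrIntegers p) : ℂ_[p]) Lφ →
                    ∀ nφ : ℕ, FirstUnitCoeffAt Lφ nφ →
                    ∀ n : ℕ, ‖((PowerSeries.coeff n Qg : 𝓞_ℂ_[p]) : ℂ_[p])‖ = 1 →
                      (∀ i < n, ‖((PowerSeries.coeff i Qg : 𝓞_ℂ_[p]) : ℂ_[p])‖ < 1) →
                        n ≤ 2 * nφ + ∑ w ∈ W.sigmaPlacesFinset p K,
                          (charLocalLambda (∅ : Set (PadicAlgCl p)) κ (θsub.restrictField K) w +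
                            charLocalLambda (∅ : Set (PadicAlgCl p)) κ (θquot.restrictField K) w)) :
    (∀ (W : WeierstrassCurve ℚ) [W.IsElliptic] [W.IsGloballyMinimal] (p : ℕ) [Fact p.Prime],
      ∀ (N : ℕ) [NeZero N] (K : Type) [Field K] [NumberField K],
        CellC W p → ¬ W.HasSplitMultiplicativeReductionAtPrime p → W.conductorNorm ℤ = N →
        IsImaginaryQuadratic K → NumberField.discr K < -4 → SatisfiesHeegnerHypothesis N K →
        Odd (NumberField.discr K) →
        ∀ (κ : ZpExtension K p), κ.IsAnticyclotomic →
          ∀ (γ : Field.absoluteGaloisGroup K) [Fact (κ.IsTopGenerator γ)]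
            (𝔭 : HeightOneSpectrum (𝓞 K)), ((p : ℕ) : 𝓞 K) ∈ 𝔭.asIdeal →
            𝔭.asIdeal.ramificationIdx (𝓞 ℚ) = 1 → 𝔭.asIdeal.inertiaDeg (𝓞 ℚ) = 1 →
            ∀ (𝔭bar : HeightOneSpectrum (𝓞 K)), ((p : ℕ) : 𝓞 K) ∈ 𝔭bar.asIdeal → 𝔭bar ≠ 𝔭 →
              ((Ideal.span {(p : ℤ)}).primesOver (𝓞 K)).ncard = 2 →
            ∀ (ι' : PadicAlgCl p ≃+* ℂ),
              (∀ (w : InfinitePlace K) (k : 𝓞 K),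
                k ∈ 𝔭.asIdeal ↔ ‖ι'.symm (w.embedding (k : K))‖ < 1) →
              ∀ (D : Skinner2016.HidaCongruentForm W p 1), (∀ x : coeffField D.g, ι' (D.ι x) = (x : ℂ)) →
                2 * ((p : ℤ) - 1) ∣ D.k - 2 →
                ∀ (ΩKg : ℂ) (Ωpg : ℂ_[p]) (Qg : PowerSeries 𝓞_ℂ_[p]), ΩKg ≠ 0 → ‖Ωpg‖ = 1 →
                  IsBDPLFunctionWtSigmaInt ι' 𝔭 κ γ D.g (W.sigmaPlacesFinset p K) ΩKg Ωpg Qg →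
                  ∀ (Φ : AddSubgroup (geomTorsion W (p : ℤ))), IsRationalLine W p Φ →
                  ∀ (θsub θquot : FramedGaloisRep ℚ (padicCoeffIntegers (∅ : Set (PadicAlgCl p))) 1),
                    IsTeichmullerLiftOn (∅ : Set (PadicAlgCl p)) (Φ.map (geomTorsion W (p : ℤ)).subtype) θsub →
                    IsTeichmullerLiftOnQuot (∅ : Set (PadicAlgCl p)) (Φ.map (geomTorsion W (p : ℤ)).subtype)
                      (geomTorsion W (p : ℤ)) θquot →
                  ∀ (φ ψ : FramedGaloisRep ℚ (padicCoeffIntegers (∅ : Set (PadicAlgCl p))) 1),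
                    (φ = θsub ∧ ψ = θquot ∨ φ = θquot ∧ ψ = θsub) →
                    (∀ u : HeightOneSpectrum (𝓞 ℚ), ((p : ℕ) : 𝓞 ℚ) ∈ u.asIdeal → φ.IsUnramifiedAt u) →
                  ∀ (θK : HeckeCharacter K), IsHeckeCharOf ι' (φ.restrictField K) θK →
                  ∀ (Cbar : Finset (HeightOneSpectrum (𝓞 K))), (∀ u ∈ Cbar, ¬ θK.IsUnramifiedAt u) →
                  ∀ (ΩK' : ℂ) (Ωp' : (unrIntegers p)ˣ) (Lφ : UnrSeries p), ΩK' ≠ 0 →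
                    IsKatzLFunction ι' 𝔭 𝔭bar Cbar κ γ θK ΩK' ((Ωp' : unrIntegers p) : ℂ_[p]) Lφ →
                  ∀ nφ : ℕ, FirstUnitCoeffAt Lφ nφ →
                  ∀ n : ℕ, ‖((PowerSeries.coeff n Qg : 𝓞_ℂ_[p]) : ℂ_[p])‖ = 1 →
                    (∀ i < n, ‖((PowerSeries.coeff i Qg : 𝓞_ℂ_[p]) : ℂ_[p])‖ < 1) →
                      n ≤ 2 * nφ + ∑ w ∈ W.sigmaPlacesFinset p K,
                        (charLocalLambda (∅ : Set (PadicAlgCl p)) κ (θsub.restrictField K) w +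
                          charLocalLambda (∅ : Set (PadicAlgCl p)) κ (θquot.restrictField K) w)) := by
  intro W _ _ p _ N _ K _ _ hC _hns
  exact hL W p N K hC

end Summit.BirchSwinnertonDyer.BirchSwinnertonDyer.Theorems.CrystalTransports

end
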